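import Mathlib
import HarnessLib

/-!
# A root near an approximate root (log-derivative lemma)

Registered sub-goal of the crux `stmt-ResolutionOfSingularities-16757`
(`Theses.AbhyankarShadows.SemivaluationShadows`), line `birth`: the downstairs half of the
TOP-LAYER TRANSPORT of the specialisation engine (CORE.md §1). Over an algebraically closed valued
field `(M, w)` no henselian theory is needed to find a root of `h` near an approximate root `a`:
writing `h = c ∏ (X - ζ_i)`, the logarithmic derivative gives `h'(a)/h(a) = Σ_i 1/(a - ζ_i)`, so by
the ultrametric inequality some root `ζ_i` satisfies `w(a - ζ_i) · w(h'(a)) ≤ w(h(a))`.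

## Sources
* folklore (Newton–Hensel root distance; here via `Polynomial.Splits.eval_derivative_eq_eval_mul_sum`).
-/

-- single-problem summit: the doubled namespace component `ResolutionOfSingularities` is forced
set_option linter.dupNamespace false

noncomputable section

namespace Summit.ResolutionOfSingularities.ResolutionOfSingularities.Theorems

open Polynomial

/-- Ultrametric inequality for a multiset sum: if `w` of every summand is `< g ≠ 0`, so is `w` of
the sum. -/
theorem valuation_multiset_sum_lt {M Γ₀ : Type*} [Field M]
    [LinearOrderedCommGroupWithZero Γ₀] (w : Valuation M Γ₀) {g : Γ₀} (hg : g ≠ 0)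
    (s : Multiset M) (hs : ∀ x ∈ s, w x < g) : w s.sum < g := by
  induction s using Multiset.induction_on with
  | empty => simpa using zero_lt_iff.mpr hg
  | cons a s ih =>
    rw [Multiset.sum_cons]
    exact Valuation.map_add_lt w (hs a (Multiset.mem_cons_self a s))
      (ih fun x hx => hs x (Multiset.mem_cons_of_mem hx))

/-- **A root near an approximate root.** Over an algebraically closed field `M` with a valuation
`w`, for every polynomial `h` and every `a` with `h'(a) ≠ 0` there is a root `ζ` of `h` with
`w(a - ζ) · w(h'(a)) ≤ w(h(a))`. (If `h(a) = 0` take `ζ = a`; otherwise `h'(a)/h(a) = Σ 1/(a - ζ_i)`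
over the roots, and the ultrametric inequality.) -/
theorem exists_root_valuation_sub_mul_le : ∀ {M Γ₀ : Type*} [Field M] [IsAlgClosed M] [LinearOrderedCommGroupWithZero Γ₀] (w : Valuation M Γ₀) (h : Polynomial M) (a : M), Polynomial.eval a (Polynomial.derivative h) ≠ 0 → ∃ ζ : M, Polynomial.eval ζ h = 0 ∧ w (a - ζ) * w (Polynomial.eval a (Polynomial.derivative h)) ≤ w (Polynomial.eval a h) := by
  intro M Γ₀ _ _ _ w h a hder
  classical
  by_cases ha : h.eval a = 0
  · exact ⟨a, ha, by simp⟩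
  have h0 : h ≠ 0 := fun e => ha (by simp [e])
  have hsplit : h.Splits := IsAlgClosed.splits h
  have hsum := hsplit.eval_derivative_eq_eval_mul_sum ha
  -- if every root were far from `a`, the sum `Σ 1/(a - ζ_i)` would be too small
  by_contra hcon
  simp only [not_exists, not_and, not_le] at hcon
  have hwa : w (h.eval a) ≠ 0 := (Valuation.ne_zero_iff w).mpr ha
  have hwd : w (h.derivative.eval a) ≠ 0 := (Valuation.ne_zero_iff w).mpr hder
  set g : Γ₀ := w (h.derivative.eval a) / w (h.eval a) with hg
  have hg0 : g ≠ 0 := div_ne_zero hwd hwa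
  have hlt : w ((h.roots.map fun z => 1 / (a - z)).sum) < g := by
    refine valuation_multiset_sum_lt w hg0 _ fun x hx => ?_
    obtain ⟨z, hz, rfl⟩ := Multiset.mem_map.mp hx
    have hroot : h.eval z = 0 := ((mem_roots h0).mp hz).eq_zero
    have hfar := hcon z hroot
    have haz : a - z ≠ 0 := by
      rintro e
      rw [e, map_zero, zero_mul] at hfar
      exact (not_lt.mpr zero_le) hfar
    have hwaz : w (a - z) ≠ 0 := (Valuation.ne_zero_iff w).mpr haz
    rw [map_div₀, map_one, one_div, hg, lt_div_iff₀ (zero_lt_iff.mpr hwa),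
      inv_mul_lt_iff₀ (zero_lt_iff.mpr hwaz)]
    exact hfar
  have key : w (h.derivative.eval a) < w (h.derivative.eval a) := by
    calc w (h.derivative.eval a)
        = w ((h.roots.map fun z => 1 / (a - z)).sum) * w (h.eval a) := by
          rw [hsum, map_mul, mul_comm]
      _ < g * w (h.eval a) := mul_lt_mul_of_pos_right hlt (zero_lt_iff.mpr hwa)
      _ = w (h.derivative.eval a) := by rw [hg, div_mul_cancel₀ _ hwa]
  exact lt_irrefl _ key

end Summit.ResolutionOfSingularities.ResolutionOfSingularities.Theorems

end
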